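/- Copyright: the b2b-balaban cell (near-miss cell 7), T⁴-continuum fan-out; row NE7b ROUND-2 swarm, seat
t4-ne7b-formalise-leaf-01 gen 5 (row X of `t4/b2b-balaban-t4-ne7b-p1/LEAVES-NE7b.md`: reader's corollary to the OWNER's
sub-row S12g file 4; XREAD verdict journal l.14691).  Released under the licence of the surrounding project. -/
import Summits.QuantumFields.BalabanUV.T4Continuum.Support.HistoryRealiseCellsRunWindow

/-!
# Realised histories at the apex: THE COUPLING WINDOW AND THE SMALL-COUPLING PREFIX ARE ONE HYPOTHESIS

Summits-side support leaf of the T⁴-continuum cell (rung (B)+1 on a FINITE torus only; NOT infinite volume, NOT the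
mass gap, NOT the Clay statement; NOT a proof of the spine estimate NE7b).  Row NE7b, route «COUNT», node A12-I, owner
sub-row S12g «APEX»: a reader's sibling to file 4 `HistoryRealiseCellsRunWindow` (p219722) and file 3 v1.1
`HistoryRealiseCellsRunHeadline` (`…_fsc`, p219850, the HEADLINE FORM OF RECORD).  [folklore] order bookkeeping on the
quantifier prefixes of OUR OWN statements; nothing is quoted from print, nothing printed is asserted, no `[cite:]` tag,
no definition, no `Prop`-valued fact minted.

WHAT.  File 4 displays the count-road witnesses on a UNIFORM coupling window
`∃ γH > 0, ∃ gH > 0, ∀ γ ≤ γH, ∀ g ≤ gH, ∀ g₀ tuned within ]0, γ] to g, …`; the form of record displays them under the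
prefix `T4ContinuumYM4Torus.ForSmallCouplings D …` = `∃ γ₀ > 0, ∀ γ ≤ γ₀, ∃ g₁(γ) > 0, ∀ g ≤ g₁, ∀ g₀ tuned, …` (the
`g`-threshold may depend on `γ`).  Because tuning is MONOTONE IN `γ` (`tuned_mono_gamma`: a run inside `]0, γ]` is
inside `]0, γ']` for `γ ≤ γ'` — immediate from the definitions of `FiniteEpsData.Tuned` ∕ `Flow.InInterval`) and the
conclusion does not mention `γ`, the two prefixes are EQUIVALENT for every conclusion `c : (ℕ → ℝ) → Prop`:
**`forSmallCouplings_iff_window`** (window ⇒ prefix with the constant threshold `gH`; prefix ⇒ window with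
`γH := γ₀`, `gH := g₁(γ₀)`).  EXACTLY WHAT HOLDS (owner v3.37 (3) asked for the honest direction): the easy direction
is «uniform window ⇒ prefix»; the converse is NOT merely «prefix ⇒ window with a γ-dependent threshold» but a genuine
UNIFORM window, because a sequence tuned within `]0, γ]` for some `γ ≤ γ₀` is tuned within `]0, γ₀]`, where the single
threshold `g₁(γ₀)` applies — so both directions are theorems and the statement below is an `↔`, kernel-checked; no
direction is displayed or assumed.  Hence file 4's three `…_window` theorems and file 3's `…_fsc` theorems are corollaries of
one another; §2 records the two directions at the apex and at the headline as kernel-checked `example`s (one-line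
compositions BY NAME; they are not declarations: each direction's statement IS the other file's theorem, which the
gate's dedup lint confirms) — no new content, only the bookkeeping that the typer's diagnostic T-NE7b-12 has ONE
resolution in two spellings.

HONEST READING.  Unchanged from files 3∕4: `ContinuumYM4Torus D ⇐ (B) ∧ BetaPertHyp ∧ [for all small-coupling tuned
runs (equivalently: on a uniform coupling window) and all loop strings, a count-road witness]`; the witness DISPLAYS H3,
E1∕E2, the (B)-side data, NE7c's `ShellWeightBound`, NE7's `ReindexedBudget` and four rates — NOTHING of them is
discharged here or anywhere; spine 0∕9 UNCHANGED; NE7b NOT proved.  HONEST DEPENDENCY (cell): continuum YM on T⁴ ⇐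
BetaPertH ∧ nine spine estimates (0/9 proved); BetaPertH ⇐ (D1) ∧ (D4) ∧ CAP+tail; G-an2-4 gates asym, D1 and NE2/3/4.
This file changes none of it. -/

open Literature.MathematicalPhysics.QuantumFieldTheory.Balaban1983to89
open T4Continuum T4PrintedShapeBanking T4CanonicalMenus
open Summit.QuantumFields.BalabanUV.T4Continuum.CountThresholdUniform
open Summit.QuantumFields.BalabanUV.T4Continuum.HistoryConstants
open Summit.QuantumFields.BalabanUV.T4Continuum.HistoryRealiseCellsRunPinned
open Summit.QuantumFields.BalabanUV.T4Continuum.HistoryRealiseCellsRunApex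
open Summit.QuantumFields.BalabanUV.T4Continuum.HistoryRealiseCellsRunHeadline
open Summit.QuantumFields.BalabanUV.T4Continuum.HistoryRealiseCellsRunWindow

namespace Summit.QuantumFields.BalabanUV.T4Continuum.HistoryRealiseCellsRunWindowIff

/-! ## §1 Tuning is monotone in `γ`; the window and the prefix coincide -/

section Prefix

variable {F : T4Family} {G : Type*} [GaugeGroup G] [MeasurableSpace G] [HaarData G]

/-- **TUNING IS MONOTONE IN `γ`**: a bare-coupling sequence tuned to `g` within `]0, γ]` is tuned to `g` within
`]0, γ']` for every `γ ≤ γ'` (from the definitions of `FiniteEpsData.Tuned` and `Flow.InInterval` alone; the `Flow`-level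
statement is `B14Cor3.inInterval_of_le`). [folklore] -/
theorem tuned_mono_gamma (D : FiniteEpsData F G) {γ γ' g : ℝ} {g₀ : ℕ → ℝ} (h : D.Tuned γ g g₀) (hle : γ ≤ γ') :
    D.Tuned γ' g g₀ :=
  fun K => ⟨fun k hk => ⟨((h K).1 k hk).1, ((h K).1 k hk).2.trans hle⟩, (h K).2⟩

/-- **THE SMALL-COUPLING PREFIX IS A UNIFORM COUPLING WINDOW.**  For every conclusion `c` on bare-coupling sequences,
`ForSmallCouplings D c` (threshold `g₁` allowed to depend on `γ`) holds iff `c` holds for every run tuned within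
`]0, γ]` to `g` with `γ ≤ γH`, `g ≤ gH` for SOME positive `γH, gH` (file 4's display).  (⇐) constant threshold;
(⇒) `γH := γ₀`, `gH := g₁(γ₀)` and `tuned_mono_gamma`. [folklore] -/
theorem forSmallCouplings_iff_window (D : FiniteEpsData F G) (c : (ℕ → ℝ) → Prop) :
    T4ContinuumYM4Torus.ForSmallCouplings D c ↔
      ∃ γH : ℝ, 0 < γH ∧ ∃ gH : ℝ, 0 < gH ∧ ∀ (γ g : ℝ) (g₀ : ℕ → ℝ), 0 < γ → γ ≤ γH → 0 < g → g ≤ gH →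
        D.Tuned γ g g₀ → c g₀ := by
  constructor
  · rintro ⟨γ₀, hγ₀, H⟩
    obtain ⟨g₁, hg₁, Hg⟩ := H γ₀ hγ₀ le_rfl
    exact ⟨γ₀, hγ₀, g₁, hg₁, fun γ g g₀ _ hγle hg hgle ht => Hg g hg hgle g₀ (tuned_mono_gamma D ht hγle)⟩
  · rintro ⟨γH, hγH, gH, hgH, H⟩
    exact ⟨γH, hγH, fun γ hγ hγle => ⟨gH, hgH, fun g hg hgle g₀ ht => H γ g g₀ hγ hγle hg hgle ht⟩⟩

end Prefix

/-! ## §2 The window theorems and the `_fsc` theorems are corollaries of one another (examples) -/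

section Apex

variable {F : T4Family} {G : Type*} [GaugeGroup G] [MeasurableSpace G] [HaarData G] [RegularGaugeGroup G]

/-- file 4's `hybridNE7Under_of_countRoad_window` FROM file 3 v1.1's `hybridNE7Under_of_countRoad_fsc` (same binder
list; CONDITIONAL; NE7b NOT proved). [folklore] -/
example (D : FiniteEpsData F G) (hM : D.AvgMeasurable)
    (hsign : B16.SignConventions D.C) {C : T4PrintedShapeBanking.Consts} {O : PrintedO1s} (hD : Dominates C O)
    {rr : ℕ} {β₀ : ℝ} (h : ThresholdOK C F.L rr β₀) (hμ : 0 < C.μ) (d n : ℕ)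
    (hκ₁ : (d : ℝ) * Real.log F.L + 2 * Real.log 2 ≤ C.κ₁) (hE₀ : Real.log (2 + birthMass C) ≤ C.E₀)
    (hβ₀ : 0 < β₀) (hLβ : (F.L : ℝ) * β₀ ≤ 1) (hn₁ : 13 ≤ C.n₁) (hn : 0 < n)
    (hData : ∃ γH : ℝ, 0 < γH ∧ ∃ gH : ℝ, 0 < gH ∧ ∀ (γ g : ℝ) (g₀ : ℕ → ℝ), 0 < γ → γ ≤ γH → 0 < g → g ≤ gH →
      D.Tuned γ g g₀ → ∀ os : List (ULoop F), ∃ (ι α π : Type) (_ : DecidableEq ι) (_ : DecidableEq α)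
        (_ : DecidableEq π), Nonempty (CountRoadWitness D C O rr d n g₀ os ι α π)) :
    T4ApexHybrid.HybridNE7Under D (BetaPertHyp D.βfun) :=
  hybridNE7Under_of_countRoad_fsc D hM hsign hD h hμ d n hκ₁ hE₀ hβ₀ hLβ hn₁ hn
    ((forSmallCouplings_iff_window D _).2 hData)

/-- … and CONVERSELY file 3 v1.1's `hybridNE7Under_of_countRoad_fsc` FROM file 4's window theorem. [folklore] -/
example (D : FiniteEpsData F G) (hM : D.AvgMeasurable)
    (hsign : B16.SignConventions D.C) {C : T4PrintedShapeBanking.Consts} {O : PrintedO1s} (hD : Dominates C O)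
    {rr : ℕ} {β₀ : ℝ} (h : ThresholdOK C F.L rr β₀) (hμ : 0 < C.μ) (d n : ℕ)
    (hκ₁ : (d : ℝ) * Real.log F.L + 2 * Real.log 2 ≤ C.κ₁) (hE₀ : Real.log (2 + birthMass C) ≤ C.E₀)
    (hβ₀ : 0 < β₀) (hLβ : (F.L : ℝ) * β₀ ≤ 1) (hn₁ : 13 ≤ C.n₁) (hn : 0 < n)
    (hData : T4ContinuumYM4Torus.ForSmallCouplings D fun g₀ => ∀ os : List (ULoop F),
        ∃ (ι α π : Type) (_ : DecidableEq ι) (_ : DecidableEq α) (_ : DecidableEq π),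
          Nonempty (CountRoadWitness D C O rr d n g₀ os ι α π)) :
    T4ApexHybrid.HybridNE7Under D (BetaPertHyp D.βfun) :=
  hybridNE7Under_of_countRoad_window D hM hsign hD h hμ d n hκ₁ hE₀ hβ₀ hLβ hn₁ hn
    ((forSmallCouplings_iff_window D _).1 hData)

end Apex

section SU

variable {F : T4Family} {N : ℕ} [NeZero N] {ℰ : LoopAverage (Matrix.specialUnitaryGroup (Fin N) ℂ)}

/-- the windowed HEADLINE `continuumYM4Torus_of_countRoad_window` FROM the headline form of record
`continuumYM4Torus_of_countRoad_fsc` (CONDITIONAL on (B), BetaPertHyp and the displayed witnesses; NE7b NOT proved;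
0∕9). [folklore] -/
example (D : FiniteEpsData F (Matrix.specialUnitaryGroup (Fin N) ℂ))
    (hBA : D.IsBlockAveraged ℰ) (hE : ℰ.MeasurableE)
    (hB : B16.EndStatementBPrinted D.C) (hβ : BetaPertHyp D.βfun) (hsign : B16.SignConventions D.C)
    {C : T4PrintedShapeBanking.Consts} {O : PrintedO1s} (hD : Dominates C O)
    {rr : ℕ} {β₀ : ℝ} (h : ThresholdOK C F.L rr β₀) (hμ : 0 < C.μ) (d n : ℕ)
    (hκ₁ : (d : ℝ) * Real.log F.L + 2 * Real.log 2 ≤ C.κ₁) (hE₀ : Real.log (2 + birthMass C) ≤ C.E₀)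
    (hβ₀ : 0 < β₀) (hLβ : (F.L : ℝ) * β₀ ≤ 1) (hn₁ : 13 ≤ C.n₁) (hn : 0 < n)
    (hData : ∃ γH : ℝ, 0 < γH ∧ ∃ gH : ℝ, 0 < gH ∧ ∀ (γ g : ℝ) (g₀ : ℕ → ℝ), 0 < γ → γ ≤ γH → 0 < g → g ≤ gH →
      D.Tuned γ g g₀ → ∀ os : List (ULoop F), ∃ (ι α π : Type) (_ : DecidableEq ι) (_ : DecidableEq α)
        (_ : DecidableEq π), Nonempty (CountRoadWitness D C O rr d n g₀ os ι α π)) :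
    T4ContinuumYM4Torus.ContinuumYM4Torus D :=
  continuumYM4Torus_of_countRoad_fsc D hBA hE hB hβ hsign hD h hμ d n hκ₁ hE₀ hβ₀ hLβ hn₁ hn
    ((forSmallCouplings_iff_window D _).2 hData)

/-- … and CONVERSELY the headline form of record FROM the windowed headline. [folklore] -/
example (D : FiniteEpsData F (Matrix.specialUnitaryGroup (Fin N) ℂ))
    (hBA : D.IsBlockAveraged ℰ) (hE : ℰ.MeasurableE)
    (hB : B16.EndStatementBPrinted D.C) (hβ : BetaPertHyp D.βfun) (hsign : B16.SignConventions D.C)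
    {C : T4PrintedShapeBanking.Consts} {O : PrintedO1s} (hD : Dominates C O)
    {rr : ℕ} {β₀ : ℝ} (h : ThresholdOK C F.L rr β₀) (hμ : 0 < C.μ) (d n : ℕ)
    (hκ₁ : (d : ℝ) * Real.log F.L + 2 * Real.log 2 ≤ C.κ₁) (hE₀ : Real.log (2 + birthMass C) ≤ C.E₀)
    (hβ₀ : 0 < β₀) (hLβ : (F.L : ℝ) * β₀ ≤ 1) (hn₁ : 13 ≤ C.n₁) (hn : 0 < n)
    (hData : T4ContinuumYM4Torus.ForSmallCouplings D fun g₀ => ∀ os : List (ULoop F),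
        ∃ (ι α π : Type) (_ : DecidableEq ι) (_ : DecidableEq α) (_ : DecidableEq π),
          Nonempty (CountRoadWitness D C O rr d n g₀ os ι α π)) :
    T4ContinuumYM4Torus.ContinuumYM4Torus D :=
  continuumYM4Torus_of_countRoad_window D hBA hE hB hβ hsign hD h hμ d n hκ₁ hE₀ hβ₀ hLβ hn₁ hn
    ((forSmallCouplings_iff_window D _).1 hData)

end SU

end Summit.QuantumFields.BalabanUV.T4Continuum.HistoryRealiseCellsRunWindowIff
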